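import Literature.AlgebraicGeometry.HodgeTheory.CartierCocycleChernCalculus
import Literature.AlgebraicGeometry.HodgeTheory.TautologicalBundleSegre
import Literature.AlgebraicGeometry.HodgeTheory.LefschetzOneOneCartierDivisor
import Literature.AlgebraicGeometry.HodgeTheory.KodairaSerreSectionsProofs
import Literature.AlgebraicGeometry.Motives.CartierDivisorEffective
import Literature.AlgebraicGeometry.Motives.SegreHyperplaneClass
import Literature.AlgebraicGeometry.Motives.VarietiesGeometricallyIntegralProofs
import Literature.AlgebraicGeometry.Motives.VarietiesQuasiCompactProofs
import HarnessLib

/-!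
# Lefschetz's theorem on `(1,1)`-classes in embedding currency, from Serre's theorem A in divisor form

Family `hodge`, layer `Literature/AlgebraicGeometry/HodgeTheory` (sub-stub G4b of the named fact
`topHodgeClasses_spanned_by_pullbacks`, crux stmt-HodgeConjecture-2782, line `regime-split-middle-step`).
Currency: for a closed immersion `Φ : T ⟶ ℙᴷ` of a smooth projective complex variety `T` with Hodge model `A`,
the class `c_Φ = ch₁(𝒪(-1)|_T) ∈ H²(T(ℂ); ℂ)` of the tautological cocycle
(`AnalytificationKaehler.tautologicalBundle Φ A.isAnalytification`, `HodgeModel.chernCharacter`). PROVED here: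

* `exists_holomorphicLineBundle_coordChange_eq_coordFun` — the cocycle `Ψ^*𝒪(1)^an` of any morphism `Ψ : T ⟶ ℙᴷ`
  (transition functions the affine coordinates `Ψ^*(x_a/x_b) ∘ φ`, Hartshorne II Thm. 7.1) exists as a cocycle
  line bundle (an existence statement, no definition);
* `HodgeModel.chernCharacter_cartierDivisorCocycle_divisor_segre` — **hyperplane divisors add along the Segre
  embedding in `ch₁`**: for `Σ = (Φ₁, Φ₂) ≫ σ`, `ch(D_Σ) = ch(D_{Φ₁}) + ch(D_{Φ₂})` (`σ^*𝒪(1) = 𝒪(1,1)`, Hartshorne II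
  Ex. 5.11–5.12; the cocycle of `Σ` is the tensor product cocycle, `coordFun_lift_segreEmbedding`);
* `lefschetzOneOne_tautological_of_serreA` — **GRANTED Serre's theorem A in divisor form** (every effective
  Cartier `E` on `T ⊆ ℙᴺ` has `E + D_F ∼ m • H_ι` for some morphism `F : T ⟶ ℙᴹ` and hyperplane divisor `D_F` of
  `F`; Hartshorne II Thm. 5.17 with II Thm. 7.1), **every rational `(1,1)`-class of a smooth projective `T` is a
  `ℂ`-combination of the classes `c_Φ` of closed immersions `Φ : T ⟶ ℙᴷ`**: the class is `a • ch(D)` for a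
  Cartier divisor `D` (Lefschetz `(1,1)` with GAGA, `exists_eq_smul_chernCharacter_cartierDivisorCocycle`,
  Voisin I Thm. 11.30 / 11.33); `E = D + m₁ H + div t₁` is effective for a section `t₁` of `𝒪(D + m₁H)`
  (`CartierDivisor.exists_isSection_add_smul_of_isAffineOpen`); and the Chern character calculus of
  `CartierCocycleChernCalculus` (`ch` additive, invariant under linear equivalence, `ch(m • D) = m ch(D)`,
  `ch(D_Ψ) = -c_Ψ`) with the Segre additivity above gives `ch(D) = (m + 1 - m₁) ch(H) - ch(D_Σ)`,
  `Σ = (ι, F) ≫ σ`, i.e. `ch(D) ∈ span {c_ι, c_Σ}`.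

Everything is proved; no definitions, no named facts (Serre's theorem A enters as a hypothesis).

## References

* C. Voisin, *Hodge Theory and Complex Algebraic Geometry I* (CUP 2002), Thm. 11.30, Thm. 11.33, §11.1.2. [VoisinHodgeI2002]
* R. Hartshorne, *Algebraic Geometry* (GTM 52, 1977), II Thm. 5.17, II Thm. 7.1, II Ex. 5.11–5.12. [Hartshorne1977]
* U. Görtz, T. Wedhorn, *Algebraic Geometry I*, 2nd ed. (2020), (11.9), Prop. 11.21, Prop. 13.47. [GortzWedhorn2020]
* S. Kobayashi, *Differential Geometry of Complex Vector Bundles* (1987), Ch. II §1 (1.10), §2 Thm. 2.16. [Kobayashi1987]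
* J.-P. Serre, *Géométrie algébrique et géométrie analytique* (1956), §2 n°6, n°20. [SerreGAGA1956]
-/

noncomputable section

open scoped Manifold ContDiff Topology
open CategoryTheory AlgebraicGeometry TopologicalSpace Opposite Set Filter

namespace Literature.AlgebraicGeometry.HodgeTheory

open Literature.AlgebraicGeometry.Motives Literature.AlgebraicGeometry.Motives.RatFn
  Literature.AlgebraicGeometry.Motives.AlgPoints Literature.AlgebraicGeometry.Motives.AnalytificationKaehler
  Literature.NumberTheory.Transcendental Literature.Geometry.Kaehler

/-! ### Hyperplane divisors along a Segre embedding -/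

section Segre

variable {n : ℕ} {X : SchemeOver ℂ} [IsIntegral X.left]
  {E : Type*} [NormedAddCommGroup E] [NormedSpace ℂ E] [FiniteDimensional ℂ E]
  {M : Type*} [TopologicalSpace M] [ChartedSpace E M] [IsManifold 𝓘(ℂ, E) ω M] [IsManifold 𝓘(ℝ, E) ∞ M]
  {φ : M → ComplexPoints X} (hφ : IsAnalytification E X n φ)

omit [IsIntegral X.left] [IsManifold 𝓘(ℂ, E) ω M] [IsManifold 𝓘(ℝ, E) ∞ M] in
include hφ in
/-- **The cocycle `Ψ^*𝒪(1)^an` of a morphism `Ψ : X ⟶ ℙᴷ` as a cocycle line bundle** (Voisin's convention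
`σ_a = g_ab σ_b` with `g_ab = Ψ^*(x_a/x_b) ∘ φ`, on the chart domains `φ⁻¹(Ψ⁻¹D₊(x_a)(ℂ))`; the ratios are
regular, hence holomorphic on an analytification, Serre GAGA §2 n°6; Hartshorne II Thm. 7.1 (a): the `Ψ^*x_a`
generate `Ψ^*𝒪(1)`). Recorded as an existence statement (no definition). [cite: Hartshorne1977, II Thm. 7.1 (a)]
[cite: SerreGAGA1956, §2 n°6] -/
theorem exists_holomorphicLineBundle_coordChange_eq_coordFun {K : ℕ} (Ψ : X ⟶ projectiveSpace K ℂ) :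
    ∃ L : HolomorphicLineBundle (Fin (K + 1)) E M,
      (∀ a, L.baseSet a = chartDom Ψ φ a) ∧ ∀ a b x, L.coordChange a b x = coordFun Ψ φ b x a :=
  ⟨⟨fun a ↦ chartDom Ψ φ a, fun a ↦ isOpen_chartDom hφ a, exists_mem_chartDom, fun a b x ↦ coordFun Ψ φ b x a,
    fun a b ↦ (IsAnalytification.mdifferentiableOn_evalOrZero_opens_holds hφ ((GeneratingSections.affineChartData Ψ).U b)
      ((GeneratingSections.affineChartData Ψ).ratio b a)).mono inter_subset_right,
    fun a b x hx ↦ (coordFun_ne_zero_iff hx.2).2 hx.1,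
    fun a b c x hx ↦ by
      rw [mul_comm]
      exact coordFun_mul_coordFun hx.2 hx.1.2 a⟩, fun _ ↦ rfl, fun _ _ _ ↦ rfl⟩

/-- **Hyperplane divisors add along the Segre embedding, in `ch₁`**: for morphisms `Φ₁ : X ⟶ ℙᴺ`, `Φ₂ : X ⟶ ℙᴹ`
and `Σ = (Φ₁, Φ₂) ≫ σ` (`Motives.segreEmbedding`, coordinates `z_{(a,b)} = x_a y_b`), the hyperplane divisor
`D_Σ = (Σ^*z_{(a,b)})` has `ch(D_Σ) = ch(D_{Φ₁,a}) + ch(D_{Φ₂,b})`: the cocycle `Σ^*𝒪(1)^an` is the tensor product of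
`Φ₁^*𝒪(1)^an` and `Φ₂^*𝒪(1)^an` (`coordFun_lift_segreEmbedding`: `Σ^*(z_{(a,b)}/z_{(a',b')}) = Φ₁^*(x_a/x_{a'}) Φ₂^*(y_b/y_{b'})`,
Hartshorne II Ex. 5.11–5.12: `σ^*𝒪(1) = 𝒪(1,1)`), the cocycles `𝒪(D_Ψ)^an` are these (`analyticallyEquivalent_cartierDivisorCocycle_divisor`)
and `ch₁` of a tensor product is the sum. [cite: Hartshorne1977, II Ex. 5.11 and Ex. 5.12] [cite: Kobayashi1987, Ch. II §1 (1.10)] -/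
theorem HodgeModel.chernCharacter_cartierDivisorCocycle_divisor_segre (A : HodgeModel n X) {N M' : ℕ}
    (Φ₁ : X ⟶ projectiveSpace N ℂ) (Φ₂ : X ⟶ projectiveSpace M' ℂ) (a : Fin (N + 1))
    (ha : genericPoint X.left ∈ (GeneratingSections.affineChartData Φ₁).U a) (b : Fin (M' + 1))
    (hb : genericPoint X.left ∈ (GeneratingSections.affineChartData Φ₂).U b)
    (hab : genericPoint X.left ∈ (GeneratingSections.affineChartData
      (CartesianMonoidalCategory.lift Φ₁ Φ₂ ≫ segreEmbedding N M' ℂ)).U (segreIndexEquiv N M' (a, b))) :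
    A.chernCharacter (cartierDivisorCocycle A.isAnalytification ((GeneratingSections.affineChartData
      (CartesianMonoidalCategory.lift Φ₁ Φ₂ ≫ segreEmbedding N M' ℂ)).divisor (segreIndexEquiv N M' (a, b)) hab)) 1 =
      A.chernCharacter (cartierDivisorCocycle A.isAnalytification ((GeneratingSections.affineChartData Φ₁).divisor a ha)) 1 +
        A.chernCharacter (cartierDivisorCocycle A.isAnalytification ((GeneratingSections.affineChartData Φ₂).divisor b hb)) 1 := by
  obtain ⟨L₁, hU₁, hg₁⟩ := exists_holomorphicLineBundle_coordChange_eq_coordFun A.isAnalytification Φ₁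
  obtain ⟨L₂, hU₂, hg₂⟩ := exists_holomorphicLineBundle_coordChange_eq_coordFun A.isAnalytification Φ₂
  have h₁ := analyticallyEquivalent_cartierDivisorCocycle_divisor A.isAnalytification Φ₁ a ha L₁.toSmoothCocycle id hU₁
    fun c d x _ ↦ hg₁ d c x
  have h₂ := analyticallyEquivalent_cartierDivisorCocycle_divisor A.isAnalytification Φ₂ b hb L₂.toSmoothCocycle id hU₂
    fun c d x _ ↦ hg₂ d c x
  have hS := analyticallyEquivalent_cartierDivisorCocycle_divisor A.isAnalytification
    (CartesianMonoidalCategory.lift Φ₁ Φ₂ ≫ segreEmbedding N M' ℂ) (segreIndexEquiv N M' (a, b)) hab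
    (L₁.tensor L₂).toSmoothCocycle (segreIndexEquiv N M') (fun p ↦ by
      rw [chartDom_lift_segreEmbedding, Equiv.symm_apply_apply, HolomorphicLineBundle.toSmoothCocycle_baseSet,
        HolomorphicLineBundle.tensor_baseSet_apply, hU₁, hU₂])
    (fun p q x _ ↦ by
      rw [coordFun_lift_segreEmbedding, Equiv.symm_apply_apply, Equiv.symm_apply_apply,
        HolomorphicLineBundle.toSmoothCocycle_coordChange_apply, HolomorphicLineBundle.tensor_coordChange_apply, hg₁, hg₂])
  rw [A.chernCharacter_eq_of_analyticallyEquivalent hS 1, A.chernCharacter_eq_of_analyticallyEquivalent h₁ 1,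
    A.chernCharacter_eq_of_analyticallyEquivalent h₂ 1]
  exact A.chernCharacter_tensor_toSmoothCocycle L₁ L₂

end Segre

/-! ### The theorem -/

/-- **Lefschetz's theorem on `(1,1)`-classes in embedding currency, from Serre's theorem A in divisor form.**
Assume (hypothesis; Hartshorne II Thm. 5.17 with II Thm. 7.1) that for every effective Cartier divisor `E` on a
smooth projective `T ⊆ ℙᴺ` (closed immersion `ι`, hyperplane divisor `H = (ι^*x_{j₀})`) there are `m`, a morphism
`F : T ⟶ ℙᴹ` and a hyperplane divisor `D_F` of `F` with `E + D_F ∼ m • H`. Then on every smooth projective `T` of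
dimension `n ≥ 1` with a Hodge model `A`, every rational class of Hodge type `(1,1)` in `H²(T(ℂ); ℂ)` is a
`ℂ`-combination of the classes `c_Φ = ch₁(𝒪(-1)|_T)` of the tautological cocycles of closed immersions `Φ : T ⟶ ℙᴷ`.
Proof: the class is `a • ch₁(𝒪_T(D)^an)` for one Cartier divisor `D` (`exists_eq_smul_chernCharacter_cartierDivisorCocycle`,
Voisin I Thm. 11.30 with GAGA); `D + m₁ H` has a non-zero section `t₁` (`CartierDivisor.exists_isSection_add_smul_of_isAffineOpen`),
so `E = D + m₁ H + div t₁` is effective (`isEffective_add_principal_iff`) and `ch(E) = ch(D) + m₁ ch(H)`; the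
hypothesis gives `ch(E) + ch(D_F) = m ch(H)`; along the Segre embedding `Σ = (ι, F) ≫ σ` (a closed immersion)
`ch(D_Σ) = ch(H) + ch(D_F)`; and `ch(H) = -c_ι`, `ch(D_Σ) = -c_Σ` (`chernCharacter_cartierDivisorCocycle_divisor_eq_neg`).
Hence `ch(D) = (m + 1 - m₁) ch(H) - ch(D_Σ) ∈ span {c_ι, c_Σ}`. [cite: VoisinHodgeI2002, Thm. 11.30 and Thm. 11.33]
[cite: Hartshorne1977, II Thm. 5.17, II Thm. 7.1 and II Ex. 5.12] [cite: GortzWedhorn2020, Prop. 11.21] -/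
theorem lefschetzOneOne_tautological_of_serreA :
    (∀ ⦃n N : ℕ⦄ ⦃T : Motives.SchemeOver ℂ⦄ [IsIntegral T.left] (_hT : Motives.IsSmoothProjective n T)
      (ι : T ⟶ Motives.projectiveSpace N ℂ) [IsClosedImmersion ι.left] (j₀ : Fin (N + 1))
      (hj₀ : genericPoint T.left ∈ (Motives.GeneratingSections.ofHom ι.left).U j₀)
      (E : Motives.CartierDivisor T.left), E.IsEffective →
      ∃ (m M : ℕ) (F : T ⟶ Motives.projectiveSpace M ℂ) (k₀ : Fin (M + 1))
        (hk₀ : genericPoint T.left ∈ (Motives.GeneratingSections.ofHom F.left).U k₀),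
        (E + (Motives.GeneratingSections.ofHom F.left).divisor k₀ hk₀).LinEquiv
          (m • (Motives.GeneratingSections.ofHom ι.left).divisor j₀ hj₀)) →
    ∀ ⦃n : ℕ⦄ ⦃T : Motives.SchemeOver ℂ⦄ (_hT : Motives.IsSmoothProjective n T) (A : HodgeModel n T), 1 ≤ n →
      ∀ y : complexBetti T (2 * 1), IsRationalClass y → IsOfHodgeType n T (2 * 1) 1 1 y →
        y ∈ Submodule.span ℂ {c : complexBetti T (2 * 1) |
          ∃ (K : ℕ) (Φ : T ⟶ Motives.projectiveSpace K ℂ) (_ : IsClosedImmersion Φ.left),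
            c = A.chernCharacter (Motives.AnalytificationKaehler.tautologicalBundle Φ A.isAnalytification) 1} := by
  intro hA n T hT A _ y hy h11
  haveI : IsIntegral T.left := IsSmoothProjective.isIntegral_holds hT
  haveI : CompactSpace T.left := hT.isProjectiveOver.compactSpace
  obtain ⟨D, a, rfl⟩ := exists_eq_smul_chernCharacter_cartierDivisorCocycle hT A y hy h11
  refine Submodule.smul_mem _ a ?_
  -- an embedding `ι : T ⟶ ℙᴺ` and its hyperplane divisor `H = (ι^*x_{j₀})`
  obtain ⟨N, ι, hι⟩ := hT.isProjectiveOver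
  set G := GeneratingSections.affineChartData ι with hG
  obtain ⟨j₀, hj₀⟩ := G.exists_mem_U (genericPoint T.left)
  -- the one-section twist: `D + m₁ H` has a non-zero section `t₁`; `E = D + m₁ H + div t₁` is effective
  have ht : ((1 : ℕ) • G.divisor j₀ hj₀).IsSection (G.ratioFn j₀ j₀ hj₀) := by
    rw [CartierDivisor.one_smul]
    exact G.isSection_divisor_ratioFn j₀ hj₀ j₀
  have ht0 : G.ratioFn j₀ j₀ hj₀ ≠ 0 := G.ratioFn_ne_zero j₀ j₀ hj₀ hj₀
  have haff : IsAffineOpen (((1 : ℕ) • G.divisor j₀ hj₀).nonvanishingOpens (G.ratioFn j₀ j₀ hj₀)) := by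
    rw [CartierDivisor.one_smul, show (G.divisor j₀ hj₀).nonvanishingOpens (G.ratioFn j₀ j₀ hj₀) = G.U j₀ from
      Opens.ext (G.nonvanishing_divisor_ratioFn j₀ hj₀ j₀)]
    exact GeneratingSections.isAffineOpen_affineChartData_U ι j₀
  obtain ⟨m₁, -, t₁, -, -, ht₁, ht₁0⟩ :=
    CartierDivisor.exists_isSection_add_smul_of_isAffineOpen D (G.divisor j₀ hj₀) one_pos ht ht0 haff
  have hE : (D + m₁ • G.divisor j₀ hj₀ + CartierDivisor.principal t₁ ht₁0).IsEffective :=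
    (CartierDivisor.isEffective_add_principal_iff ht₁0).2 ht₁
  -- Serre's theorem A in divisor form
  obtain ⟨m, M', F, k₀, hk₀, hlin⟩ := hA hT ι j₀ hj₀ _ hE
  -- the Segre embedding `Σ = (ι, F) ≫ σ`, a closed immersion
  haveI := SegreHyperplaneClass.isSeparated_projectiveSpace_hom M'
  haveI : IsClosedImmersion (CartesianMonoidalCategory.lift ι F).left := by
    have h : (CartesianMonoidalCategory.lift ι F).left ≫
        (CartesianMonoidalCategory.fst (projectiveSpace N ℂ) (projectiveSpace M' ℂ)).left = ι.left := by
      rw [← Over.comp_left, CartesianMonoidalCategory.lift_fst]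
    haveI : IsSeparated (CartesianMonoidalCategory.fst (projectiveSpace N ℂ) (projectiveSpace M' ℂ)).left :=
      inferInstanceAs (IsSeparated (Limits.pullback.fst (projectiveSpace N ℂ).hom (projectiveSpace M' ℂ).hom))
    haveI : IsClosedImmersion ((CartesianMonoidalCategory.lift ι F).left ≫
        (CartesianMonoidalCategory.fst (projectiveSpace N ℂ) (projectiveSpace M' ℂ)).left) := by
      rw [h]
      infer_instance
    exact IsClosedImmersion.of_comp _ (CartesianMonoidalCategory.fst (projectiveSpace N ℂ) (projectiveSpace M' ℂ)).left
  haveI : IsClosedImmersion (CartesianMonoidalCategory.lift ι F ≫ segreEmbedding N M' ℂ).left := by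
    rw [Over.comp_left]
    infer_instance
  have hab : genericPoint T.left ∈ (GeneratingSections.affineChartData
      (CartesianMonoidalCategory.lift ι F ≫ segreEmbedding N M' ℂ)).U (segreIndexEquiv N M' (j₀, k₀)) := by
    rw [affineChartData_lift_segreEmbedding_U]
    exact ⟨hj₀, hk₀⟩
  -- Chern character bookkeeping in `H²(T(ℂ); ℂ)`
  set cH := A.chernCharacter (cartierDivisorCocycle A.isAnalytification (G.divisor j₀ hj₀)) 1 with hcH
  set cD := A.chernCharacter (cartierDivisorCocycle A.isAnalytification D) 1 with hcD
  set cF := A.chernCharacter (cartierDivisorCocycle A.isAnalytification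
    ((GeneratingSections.affineChartData F).divisor k₀ hk₀)) 1 with hcF
  set cE := A.chernCharacter (cartierDivisorCocycle A.isAnalytification
    (D + m₁ • G.divisor j₀ hj₀ + CartierDivisor.principal t₁ ht₁0)) 1 with hcE
  set cS := A.chernCharacter (cartierDivisorCocycle A.isAnalytification ((GeneratingSections.affineChartData
    (CartesianMonoidalCategory.lift ι F ≫ segreEmbedding N M' ℂ)).divisor (segreIndexEquiv N M' (j₀, k₀)) hab)) 1 with hcS
  have e1 : cE = cD + (m₁ : ℂ) • cH := by
    rw [hcE, ← A.chernCharacter_cartierDivisorCocycle_eq_of_linEquiv ⟨t₁, ht₁0, CartierDivisor.SameDivisor.refl _⟩,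
      A.chernCharacter_cartierDivisorCocycle_add, A.chernCharacter_cartierDivisorCocycle_smul]
  have e2 : cF = (m : ℂ) • cH - cE := by
    refine eq_sub_of_add_eq' ?_
    rw [hcE, hcF, ← A.chernCharacter_cartierDivisorCocycle_add, A.chernCharacter_cartierDivisorCocycle_eq_of_linEquiv hlin,
      A.chernCharacter_cartierDivisorCocycle_smul]
  have e3 : cS = cH + cF := A.chernCharacter_cartierDivisorCocycle_divisor_segre ι F j₀ hj₀ k₀ hk₀ hab
  have key : cD = cH + (m : ℂ) • cH - (m₁ : ℂ) • cH - cS := by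
    rw [e3, e2, e1]
    abel
  have hH : cH ∈ Submodule.span ℂ {c : complexBetti T (2 * 1) |
      ∃ (K : ℕ) (Φ : T ⟶ Motives.projectiveSpace K ℂ) (_ : IsClosedImmersion Φ.left),
        c = A.chernCharacter (Motives.AnalytificationKaehler.tautologicalBundle Φ A.isAnalytification) 1} := by
    rw [hcH, A.chernCharacter_cartierDivisorCocycle_divisor_eq_neg ι j₀ hj₀]
    exact Submodule.neg_mem _ (Submodule.subset_span ⟨N, ι, hι, rfl⟩)
  have hS : cS ∈ Submodule.span ℂ {c : complexBetti T (2 * 1) |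
      ∃ (K : ℕ) (Φ : T ⟶ Motives.projectiveSpace K ℂ) (_ : IsClosedImmersion Φ.left),
        c = A.chernCharacter (Motives.AnalytificationKaehler.tautologicalBundle Φ A.isAnalytification) 1} := by
    rw [hcS, A.chernCharacter_cartierDivisorCocycle_divisor_eq_neg _ _ hab]
    exact Submodule.neg_mem _ (Submodule.subset_span ⟨_, _, inferInstance, rfl⟩)
  rw [key]
  exact Submodule.sub_mem _ (Submodule.sub_mem _ (Submodule.add_mem _ hH (Submodule.smul_mem _ _ hH))
    (Submodule.smul_mem _ _ hH)) hS

end Literature.AlgebraicGeometry.HodgeTheory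

end
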